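/-
Origin: expansion seat `planner-pub-hodgecm-pv03-g6-0`, handover #6 v2 2026-08-18T11:09:41Z (`HOME/pub-hodgecm-pv03-g6/lean/Pv03g6/TwistedNormTrace.lean`, md5 9b6b535c, 134 lines);
landed by the gen-7 packager in gate run 28 as `HodgeCM/Model/ToyG2/TwistedNormTrace.lean` (import ^import Pv03g6\.TwistedTypeNorm\b→import HodgeCM.Model.Toy.TwistedTypeNorm ×1).
-/
/-
Origin: pub-hodgecm-pv03-g6 (DAG-NODE PROVER #03, gen 6), 2026-08-18. WIP module `Pv03g6.TwistedNormTrace`, final module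
`HodgeCM.Model.ToyG2.TwistedNormTrace`; used by `HodgeCM.Model.ToyG2.SplitAllGood` (toy-g2's `SplitInput` for ALL good objects;
memo `HOME/pub-hodgecm-pv03-g6/SPLIT-ALL-GOOD.md`).

# The trace is semi-invariant under Galois-twisted type norms (Lemma A)

For a gen-2 object `X` whose trace has Hodge type `(dim X, dim X)` (`TrType X`, e.g. every good `X`)
and `α` in the Galois hull `N` of the atom fields (`Obj.N`), the coordinatewise multiplication
operator `g_α = tnorm α ∈ L X` (`Pv03g6.TwistedTypeNorm`) satisfies

  `tr_X ∘ ⋀ⁿ g_α = N_{N/ℚ}(α) ^ dim X • tr_X`   (`trOf_map_tnorm`, every degree `n`).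

Proof ("Lemma A"): the complexified trace of an eigen-monomial `e_g` is (the image in `ℂ` of) an
element `trN g ∈ N` (`baseC_mono_eq_trN`) on which `Gal(N/ℚ)` acts by twisting the index map
(`trN_twist`); hence `tr_ℂ (e_g) ≠ 0` forces `cnt (twist δ⁻¹ ∘ g) = dim X` for EVERY `δ`
(`cntTw_eq_dim_of_baseC_ne`, from `TrType` = the case `δ = 1`), and then the eigenvalue
`∏_δ δ(α)^{cntTw δ g}` of `⋀ⁿ g_α` on `e_g` (`prod_ev_tnorm`) equals `N(α)^{dim X}`.
-/
import Mathlib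
import Summits.HodgeConjecture.HodgeCM.Model.Toy.TwistedTypeNorm_2
import Summits.HodgeConjecture.HodgeCM.Model.ToyG2.TrTypeProd
import Summits.HodgeConjecture.HodgeCM.Model.ToyG2.Good
import Summits.HodgeConjecture.HodgeCM.Model.ToyG2.HodgeRieszFree

noncomputable section

open TensorProduct exteriorPower Module

namespace HodgeCM.Toy

namespace Obj

variable (X : Obj)

attribute [local instance] Classical.propDecidable

/-! ### §1 The trace of an eigen-monomial as an element of the Galois hull -/

/-- the coefficient `coef s m = σ (dF m)` as an element of `N` -/
def coefN (s : X.Idx) (m : Fin (finrank ℚ (X.atom s.1).F)) : X.N := X.toN s.1 s.2 (dF (X.atom s.1).F m)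

/-- (Ported verbatim from the HodgeCMPerL package; no docstring in the source.) -/
lemma coe_coefN (s : X.Idx) (m : Fin (finrank ℚ (X.atom s.1).F)) :
    ((X.coefN s m : X.N) : ℂ) = X.coef s m := rfl

/-- (Ported verbatim from the HodgeCMPerL package; no docstring in the source.) -/
lemma coefN_twist (δ : X.G) (s : X.Idx) (m : Fin (finrank ℚ (X.atom s.1).F)) :
    X.coefN (X.twist δ s) m = δ (X.coefN s m) := by
  show X.toN s.1 (X.twist δ s).2 (dF (X.atom s.1).F m) = _
  rw [toN_twist]
  rfl

/-- the value of (the complexification of) a rational functional `φ` on the eigen-monomial `e_g`,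
as an element of `N` -/
def trN {k : ℕ} (φ : (⋀[ℚ]^k X.L) →ₗ[ℚ] ℚ) (g : Fin k → X.Idx) : X.N :=
  ∑ M : (∀ j : Fin k, Fin (finrank ℚ (X.atom (g j).1).F)),
    (∏ j, X.coefN (g j) (M j)) * algebraMap ℚ X.N (φ (ιMulti ℚ k fun j => X.vec (g j) (M j)))

/-- (Ported verbatim from the HodgeCMPerL package; no docstring in the source.) -/
theorem baseC_mono_eq_trN {k : ℕ} (φ : (⋀[ℚ]^k X.L) →ₗ[ℚ] ℚ) (g : Fin k → X.Idx) :
    ToyG2.baseC X φ (X.mono k g) = ((X.trN φ g : X.N) : ℂ) := by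
  simp only [ToyG2.baseC, LinearMap.coe_comp, Function.comp_apply, LinearEquiv.coe_coe]
  rw [theta_symm_mono, map_sum, map_sum, trN, coe_eq_algebraMap, map_sum]
  refine Finset.sum_congr rfl (fun M _ => ?_)
  rw [LinearMap.baseChange_tmul, TensorProduct.AlgebraTensorModule.rid_tmul, map_mul,
    map_prod, ← IsScalarTower.algebraMap_apply, eq_ratCast, Rat.smul_def, mul_comm]
  rfl

/-- (Ported verbatim from the HodgeCMPerL package; no docstring in the source.) -/
theorem trN_twist {k : ℕ} (φ : (⋀[ℚ]^k X.L) →ₗ[ℚ] ℚ) (g : Fin k → X.Idx) (δ : X.G) :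
    X.trN φ (fun j => X.twist δ (g j)) = δ (X.trN φ g) := by
  rw [trN, trN, map_sum]
  refine Finset.sum_congr rfl (fun M _ => ?_)
  rw [map_mul, map_prod, AlgEquiv.commutes]
  congr 1

/-- (Ported verbatim from the HodgeCMPerL package; no docstring in the source.) -/
lemma trN_ne_zero_iff {k : ℕ} (φ : (⋀[ℚ]^k X.L) →ₗ[ℚ] ℚ) (g : Fin k → X.Idx) :
    X.trN φ g ≠ 0 ↔ ToyG2.baseC X φ (X.mono k g) ≠ 0 := by
  rw [baseC_mono_eq_trN, ne_eq, ne_eq, ZeroMemClass.coe_eq_zero]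

end Obj

end HodgeCM.Toy

namespace HodgeCM.ToyG2

open HodgeCM.Toy HodgeCM.Toy.Obj Obj₂

variable {X : Obj₂}

attribute [local instance] Classical.propDecidable

/-! ### §2 Lemma A: a monomial with non-zero trace has `dim X` holomorphic slots after every twist -/

/-- (Ported verbatim from the HodgeCMPerL package; no docstring in the source.) -/
lemma two_pow_injective {a b : ℕ} (h : (2 : ℂ) ^ a = (2 : ℂ) ^ b) : a = b := by
  have h' : ((2 ^ a : ℕ) : ℂ) = ((2 ^ b : ℕ) : ℂ) := by push_cast; exact h
  exact Nat.pow_right_injective (le_refl 2) (Nat.cast_injective h')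

/-- (Ported verbatim from the HodgeCMPerL package; no docstring in the source.) -/
theorem cnt_eq_dim_of_baseC_ne (hX : TrType X) {n : ℕ} (g : Fin n → X.toObj.Idx)
    (h : baseC X.toObj (trOf X n) (X.toObj.mono n g) ≠ 0) : X.toObj.cnt g = X.dim := by
  have e := LinearMap.congr_fun (hX n 2) (X.toObj.mono n g)
  rw [LinearMap.comp_apply, Obj.wt_mono, map_smul, LinearMap.smul_apply, smul_eq_mul, smul_eq_mul] at e
  exact two_pow_injective (mul_right_cancel₀ h e)

/-- **Lemma A.** -/
theorem cntTw_eq_dim_of_baseC_ne (hX : TrType X) {n : ℕ} (g : Fin n → X.toObj.Idx)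
    (h : baseC X.toObj (trOf X n) (X.toObj.mono n g) ≠ 0) (δ : X.toObj.G) : X.toObj.cntTw δ g = X.dim := by
  rw [Obj.cntTw_eq_cnt]
  apply cnt_eq_dim_of_baseC_ne hX
  rw [← Obj.trN_ne_zero_iff] at h ⊢
  rw [Obj.trN_twist]
  exact (map_ne_zero_iff _ (δ⁻¹).injective).mpr h

/-! ### §3 Semi-invariance of the trace under `⋀ⁿ (tnorm α)` -/

/-- (Ported verbatim from the HodgeCMPerL package; no docstring in the source.) -/
theorem baseC_trOf_comp_map_tnorm (hX : TrType X) (α : X.toObj.N) (n : ℕ) :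
    baseC X.toObj (trOf X n) ∘ₗ map n ((X.toObj.mulL (X.toObj.tnorm α)).baseChange ℂ)
      = (((Algebra.norm ℚ α : ℚ) : ℂ) ^ X.dim) • baseC X.toObj (trOf X n) := by
  refine LinearMap.ext_on_range (X.toObj.span_mono_eq_top n) (fun g => ?_)
  rw [LinearMap.comp_apply, LinearMap.smul_apply, Obj.map_mono]
  have h1 : (fun j => (X.toObj.mulL (X.toObj.tnorm α)).baseChange ℂ (X.toObj.eB (g j)))
      = fun j => X.toObj.ev (X.toObj.tnorm α) (g j) • X.toObj.eB (g j) := funext fun j => X.toObj.mulL_eB _ _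
  rw [h1, AlternatingMap.map_smul_univ, ← Obj.mono, map_smul, smul_eq_mul, smul_eq_mul]
  by_cases hT : baseC X.toObj (trOf X n) (X.toObj.mono n g) = 0
  · rw [hT, mul_zero, mul_zero]
  · rw [X.toObj.prod_ev_tnorm_of_cntTw α g (cntTw_eq_dim_of_baseC_ne hX g hT)]

/-- **The trace is semi-invariant under the Galois-twisted type norms**, with rational character
`N(α) ^ dim X`, in every degree. -/
theorem trOf_map_tnorm (hX : TrType X) (α : X.toObj.N) (n : ℕ) (x : ⋀[ℚ]^n X.L) :
    trOf X n (map n (X.toObj.mulL (X.toObj.tnorm α)) x) = (Algebra.norm ℚ α) ^ X.dim * trOf X n x := by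
  have h1 := baseC_theta_one_tmul X.toObj (trOf X n ∘ₗ map n (X.toObj.mulL (X.toObj.tnorm α))) x
  rw [baseC_comp_map, baseC_trOf_comp_map_tnorm hX, LinearMap.smul_apply, baseC_theta_one_tmul,
    LinearMap.comp_apply, smul_eq_mul] at h1
  exact_mod_cast h1.symm

end HodgeCM.ToyG2
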